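import Summits.NavierStokesRegularity.NavierStokesRegularity.Theorems.OddMorawetzLocal.Negative.OddMorawetzLocalSymmetryDefs

/-!
# Crux `OddMorawetzLocal` (stmt-NavierStokesRegularity-1376) — computable jet algebra (vocabulary of the refutation)

Definitions only (plus `rfl`-level unfolding lemmas), consumed by the refutation files
`Theorems/OddMorawetzOddMorawetzLocal*.lean` of the line `registered` (lead c1) and by their `decide` computations.
The refutation of the crux represents a smooth cubic isobaric jet density as a POLYNOMIAL in the symmetric jet
coordinates `∂^α v_a`, averages its coefficient vector over `O(3)`, pins the average to the explicit isotropic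
densities by a modular rank certificate, reduces those modulo total divergences on divergence-free jets, and evaluates
the two surviving functionals exactly. Every algebraic step is a finite computation on the objects below, checked by
`decide` in the kernel, and transported to analysis by the semantics `JPoly.evalA` / `JPoly.dens` / `JPoly.lin` /
`jetVal`.

* `JVar = Fin 3 × List (Fin 3)` — the jet coordinate `∂^α v_a`: component `a` and the SORTED list of derivative indices
  (`|α| ≤ 3` throughout); `JVar.coord v : Jet3 →L[ℝ] ℝ` the corresponding coordinate of an abstract 3-jet (zero for
  longer lists); `jetVal u x : JVar → ℝ` the actual partial derivatives of a field `u` at `x` (all orders).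
* `JPoly R = List (R × List JVar)` — sparse polynomials (coefficient, monomial = list of variables); semantics
  `evalA` (value at an assignment `JVar → ℝ`), `dens` (the density `Jet3 → ℝ`), `lin` (its linearisation
  `Σ ∂p/∂v · η v`, the integrand of the Euler derivative); `JPoly.cast : JPoly ℚ → JPoly ℝ`.
* computable algebra over a ring `R`: `norm` (sort, collect, drop zeros), `add/neg/smul/mul`, `isZero`, `coeffOf`,
  the total derivative `D i`, the flux divergence `divergence`, the divergence-free normal form `nf` (eliminate
  `∂^α ∂₂ v₂ = -∂^α ∂₀ v₀ - ∂^α ∂₁ v₁`), the substitution action `act g` of a `3 × 3` matrix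
  (`v ↦ g v(gᵀ·)`, i.e. `p ↦ p ∘ jetAct g` on symmetric jets) and its zero-pruned twin `actP g` for the kernel.
* enumerations: `sortedIdx n` (sorted index lists), `idx k` (all sorted cubic monomials of weight `k`, jet orders
  `≤ 3` — the coordinates of the coefficient space `V k = Fin (idx k).length → ℝ`), `densV`, `polyOfV`, the matrix
  `actMatrix k g` of the action on `V k`, the 48 signed permutations `b3List` / `signedPermMatrix`, their monomial action `permAct` and orbit sums `orbitSum`, the rational rotation
  `rotZ` (`cos = 3/5`, `sin = 4/5`), and the isotropic contraction densities `contractions k`.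

Plain `def`s over Mathlib; kernel computations are structurally recursive on lists; nothing restates a tree notion
(`lean search` 2026-08-17: no jet-polynomial vocabulary in the tree; `OddMorawetzDefs` = polynomial-Gaussian FIELDS).
-/

set_option linter.dupNamespace false
set_option autoImplicit false

namespace Summit.NavierStokesRegularity.NavierStokesRegularity.Theorems.OddMorawetz

/-! ### Jet variables and coordinates -/

/-- A jet coordinate `∂^α v_a`: the component `a : Fin 3` and the (sorted) list of derivative indices. -/
abbrev JVar := Fin 3 × List (Fin 3)

/-- The standard basis vector `e i` of `ℝ³`. -/
noncomputable abbrev stdVec (i : Fin 3) : EuclideanSpace ℝ (Fin 3) := EuclideanSpace.single i (1 : ℝ)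

/-- The coordinate `∂^α v_a` of an abstract 3-jet `z = (z₀, z₁, z₂, z₃)`, as a continuous linear functional:
`z₀ a`, `z₁(e_i) a`, `z₂(e_i, e_j) a`, `z₃(e_i, e_j, e_l) a` according to the index list, and `0` for lists of
length `≥ 4` (the crux's densities see 3-jets only). -/
noncomputable def JVar.coord : JVar → (Jet3 →L[ℝ] ℝ)
  | (a, []) => (EuclideanSpace.proj a).comp (ContinuousLinearMap.fst ℝ _ _)
  | (a, [i]) => (EuclideanSpace.proj a).comp
      ((ContinuousMultilinearMap.apply ℝ (fun _ : Fin 1 => EuclideanSpace ℝ (Fin 3)) (EuclideanSpace ℝ (Fin 3))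
          (fun _ => stdVec i)).comp
        ((ContinuousLinearMap.fst ℝ _ _).comp (ContinuousLinearMap.snd ℝ _ _)))
  | (a, [i, j]) => (EuclideanSpace.proj a).comp
      ((ContinuousMultilinearMap.apply ℝ (fun _ : Fin 2 => EuclideanSpace ℝ (Fin 3)) (EuclideanSpace ℝ (Fin 3))
          ![stdVec i, stdVec j]).comp
        ((ContinuousLinearMap.fst ℝ _ _).comp ((ContinuousLinearMap.snd ℝ _ _).comp (ContinuousLinearMap.snd ℝ _ _))))
  | (a, [i, j, l]) => (EuclideanSpace.proj a).comp
      ((ContinuousMultilinearMap.apply ℝ (fun _ : Fin 3 => EuclideanSpace ℝ (Fin 3)) (EuclideanSpace ℝ (Fin 3))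
          ![stdVec i, stdVec j, stdVec l]).comp
        ((ContinuousLinearMap.snd ℝ _ _).comp ((ContinuousLinearMap.snd ℝ _ _).comp (ContinuousLinearMap.snd ℝ _ _))))
  | (_, _ :: _ :: _ :: _ :: _) => 0

/-- The actual partial derivative `∂^α u_a (x) = Dⁿu(x)(e_{α₁}, …, e_{αₙ})_a` of a field (every order `n`). -/
noncomputable def jetVal (u : EuclideanSpace ℝ (Fin 3) → EuclideanSpace ℝ (Fin 3)) (x : EuclideanSpace ℝ (Fin 3)) :
    JVar → ℝ :=
  fun v => iteratedFDeriv ℝ v.2.length u x (fun t => stdVec (v.2.get t)) v.1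

/-! ### Sparse jet polynomials and their semantics -/

/-- Sparse polynomials in jet coordinates over a coefficient type `R`: a list of (coefficient, monomial), a monomial
being a list of variables (repetition = powers). No invariant is enforced; `JPoly.norm` sorts and collects. -/
abbrev JPoly (R : Type) := List (R × List JVar)

namespace JPoly

/-- Value of a real jet polynomial at an assignment of the variables. -/
noncomputable def evalA (p : JPoly ℝ) (ζ : JVar → ℝ) : ℝ := (p.map fun t => t.1 * (t.2.map ζ).prod).sum

/-- Coefficient cast `ℚ → ℝ`. -/
noncomputable def cast (p : JPoly ℚ) : JPoly ℝ := p.map fun t => ((t.1 : ℝ), t.2)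

/-- The density `Jet3 → ℝ` of a real jet polynomial (evaluate at the coordinates of the abstract jet). -/
noncomputable def dens (p : JPoly ℝ) : Jet3 → ℝ := fun z => p.evalA fun v => JVar.coord v z

/-- Leibniz linearisation of a monomial: `Σ_i (Π_{j<i} ζ vⱼ) · η vᵢ · (Π_{j>i} ζ vⱼ)` written recursively. -/
noncomputable def prodDeriv : List JVar → (JVar → ℝ) → (JVar → ℝ) → ℝ
  | [], _, _ => 0
  | v :: vs, ζ, η => η v * (vs.map ζ).prod + ζ v * prodDeriv vs ζ η

/-- The linearisation `Dp(ζ)[η] = Σ_v ∂p/∂v (ζ) · η v` of a real jet polynomial (the Euler-derivative integrand is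
`lin p (jetVal v x) (jetVal b x)`). -/
noncomputable def lin (p : JPoly ℝ) (ζ η : JVar → ℝ) : ℝ := (p.map fun t => t.1 * prodDeriv t.2 ζ η).sum

end JPoly

/-! ### Orders on variables and monomials (for normal forms) -/

/-- Lexicographic comparison of index lists (shorter-is-smaller on common prefixes). -/
def idxCmp : List (Fin 3) → List (Fin 3) → Ordering
  | [], [] => .eq
  | [], _ :: _ => .lt
  | _ :: _, [] => .gt
  | i :: is, j :: js => if i < j then .lt else if j < i then .gt else idxCmp is js

/-- Comparison of variables: by component, then by index list. -/
def JVar.cmp (v w : JVar) : Ordering :=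
  if v.1 < w.1 then .lt else if w.1 < v.1 then .gt else idxCmp v.2 w.2

/-- Comparison of monomials (lists of variables), lexicographic. -/
def monoCmp : List JVar → List JVar → Ordering
  | [], [] => .eq
  | [], _ :: _ => .lt
  | _ :: _, [] => .gt
  | v :: vs, w :: ws => match JVar.cmp v w with
    | .lt => .lt
    | .gt => .gt
    | .eq => monoCmp vs ws

/-- Sorted insertion of a derivative index into an index list. -/
def insertIdx (i : Fin 3) : List (Fin 3) → List (Fin 3)
  | [] => [i]
  | j :: js => if j < i then j :: insertIdx i js else i :: j :: js

/-- Sorting an index list. -/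
def sortIdx (l : List (Fin 3)) : List (Fin 3) := l.foldr insertIdx []

/-- Sorted insertion of a variable into a monomial. -/
def insertVar (v : JVar) : List JVar → List JVar
  | [] => [v]
  | w :: ws => match JVar.cmp w v with
    | .lt => w :: insertVar v ws
    | _ => v :: w :: ws

/-- Sorting the variables of a monomial. -/
def sortVars (m : List JVar) : List JVar := m.foldr insertVar []

namespace JPoly

variable {R : Type}

/-- Insert a term into a polynomial whose monomials are sorted increasingly, adding coefficients of equal monomials. -/
def insertTerm [Add R] (c : R) (m : List JVar) : JPoly R → JPoly R
  | [] => [(c, m)]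
  | (c', m') :: rest => match monoCmp m m' with
    | .lt => (c, m) :: (c', m') :: rest
    | .eq => (c + c', m') :: rest
    | .gt => (c', m') :: insertTerm c m rest

/-- Collect: sort the variables of every monomial, sort the monomials, add up equal ones (zeros are kept). -/
def collect [Add R] (p : JPoly R) : JPoly R := p.foldr (fun t acc => insertTerm t.1 (sortVars t.2) acc) []

/-- Normal form: `collect`, then drop zero coefficients. -/
def norm [Add R] [Zero R] [DecidableEq R] (p : JPoly R) : JPoly R := (collect p).filter fun t => t.1 ≠ 0

/-- Is the polynomial zero (after normalisation)? -/
def isZero [Add R] [Zero R] [DecidableEq R] (p : JPoly R) : Bool := (norm p).isEmpty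

/-- The coefficient of a given monomial (sum of the coefficients of all terms carrying exactly this monomial). -/
def coeffOf [Add R] [Zero R] (p : JPoly R) (m : List JVar) : R := ((p.filter fun t => t.2 = m).map fun t => t.1).sum

/-- Sum of polynomials (concatenation). -/
def add (p q : JPoly R) : JPoly R := p ++ q

/-- Scalar multiple. -/
def smul [Mul R] (c : R) (p : JPoly R) : JPoly R := p.map fun t => (c * t.1, t.2)

/-- Negation. -/
def neg [Neg R] (p : JPoly R) : JPoly R := p.map fun t => (-t.1, t.2)

/-- Difference. -/
def sub [Neg R] (p q : JPoly R) : JPoly R := p ++ neg q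

/-- Product (all pairs; monomials concatenated). -/
def mul [Mul R] (p q : JPoly R) : JPoly R := p.flatMap fun s => q.map fun t => (s.1 * t.1, s.2 ++ t.2)

/-- Product of a list of polynomials. -/
def prodList [Mul R] [One R] : List (JPoly R) → JPoly R
  | [] => [(1, [])]
  | p :: ps => mul p (prodList ps)

/-! ### Total derivatives, divergence, divergence-free normal form -/

/-- The monomials of the total derivative `D_i` of a monomial (Leibniz: differentiate one variable at a time). -/
def derivVars (i : Fin 3) : List JVar → List (List JVar)
  | [] => []
  | v :: vs => ((v.1, insertIdx i v.2) :: vs) :: (derivVars i vs).map fun l => v :: l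

/-- The total derivative `D_i p` (`D_i (∂^α v_a) = ∂^{α+e_i} v_a`, extended as a derivation). -/
def D (i : Fin 3) (p : JPoly R) : JPoly R := p.flatMap fun t => (derivVars i t.2).map fun l => (t.1, l)

/-- The divergence `D₀ F₀ + D₁ F₁ + D₂ F₂` of a flux triple. -/
def divergence (F : JPoly R × JPoly R × JPoly R) : JPoly R := D 0 F.1 ++ (D 1 F.2.1 ++ D 2 F.2.2)

/-- Substitute every variable by a polynomial and multiply out. -/
def subst [Mul R] [One R] (σ : JVar → JPoly R) (p : JPoly R) : JPoly R :=
  p.flatMap fun t => (prodList (t.2.map σ)).map fun s => (t.1 * s.1, s.2)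

/-- Remove the first occurrence of the index `2` from an index list (identity if absent). -/
def dropTwo : List (Fin 3) → List (Fin 3)
  | [] => []
  | i :: is => if i = 2 then is else i :: dropTwo is

/-- Divergence-free normal form of one variable: `∂^β ∂₂ v₂ ↦ -∂^β ∂₀ v₀ - ∂^β ∂₁ v₁`; other variables unchanged. -/
def nfVar [Neg R] [One R] (v : JVar) : JPoly R :=
  if v.1 = 2 ∧ (2 : Fin 3) ∈ v.2 then
    [(-1, [((0 : Fin 3), insertIdx 0 (dropTwo v.2))]), (-1, [((1 : Fin 3), insertIdx 1 (dropTwo v.2))])]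
  else [(1, [v])]

/-- Divergence-free normal form of a polynomial (substitute `nfVar`, multiply out, normalise). -/
def nf [Mul R] [One R] [Neg R] [Add R] [Zero R] [DecidableEq R] (p : JPoly R) : JPoly R := norm (subst nfVar p)

/-! ### The substitution action of a `3 × 3` matrix -/

/-- Images of an index list under a matrix: all target sequences `j` with the coefficient `Π_s g (l_s) (j_s)`. -/
def idxImages [Mul R] [One R] (g : Matrix (Fin 3) (Fin 3) R) : List (Fin 3) → List (R × List (Fin 3))
  | [] => [(1, [])]
  | i :: is => (List.finRange 3).flatMap fun j => (idxImages g is).map fun cj => (g i j * cj.1, j :: cj.2)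

/-- The same, pruning vanishing partial coefficients (for kernel evaluation; equal to `idxImages` after collecting). -/
def idxImagesP [Mul R] [One R] [Zero R] [DecidableEq R] (g : Matrix (Fin 3) (Fin 3) R) :
    List (Fin 3) → List (R × List (Fin 3))
  | [] => [(1, [])]
  | i :: is => (List.finRange 3).flatMap fun j =>
      if g i j = 0 then [] else (idxImagesP g is).map fun cj => (g i j * cj.1, j :: cj.2)

/-- The image of one variable under the substitution action of `g`:
`∂^l v_a ↦ Σ_{b, j} g a b · Π_s g (l_s) (j_s) · ∂^{sort j} v_b` (how the coordinate `∂^l v_a` of `jetAct g z` expands in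
the coordinates of a symmetric jet `z`; `g` acts on fields by `v ↦ g v(gᵀ ·)`). -/
def actVar [Mul R] [One R] (g : Matrix (Fin 3) (Fin 3) R) (v : JVar) : JPoly R :=
  (List.finRange 3).flatMap fun b => (idxImages g v.2).map fun cj => (g v.1 b * cj.1, [(b, sortIdx cj.2)])

/-- Zero-pruned twin of `actVar`. -/
def actVarP [Mul R] [One R] [Zero R] [DecidableEq R] (g : Matrix (Fin 3) (Fin 3) R) (v : JVar) : JPoly R :=
  (List.finRange 3).flatMap fun b =>
    if g v.1 b = 0 then [] else (idxImagesP g v.2).map fun cj => (g v.1 b * cj.1, [(b, sortIdx cj.2)])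

/-- The substitution action of a matrix on jet polynomials (`p ↦ p ∘ jetAct g` on symmetric jets), variables of
each output monomial sorted. -/
def act [Mul R] [One R] (g : Matrix (Fin 3) (Fin 3) R) (p : JPoly R) : JPoly R :=
  (subst (actVar g) p).map fun t => (t.1, sortVars t.2)

/-- Zero-pruned twin of `act` (for `decide`). -/
def actP [Mul R] [One R] [Zero R] [DecidableEq R] (g : Matrix (Fin 3) (Fin 3) R) (p : JPoly R) : JPoly R :=
  (subst (actVarP g) p).map fun t => (t.1, sortVars t.2)

end JPoly

/-! ### Enumerations: sorted index lists, the monomial basis of weight `k`, the coefficient space -/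

/-- All sorted index lists of length `n` whose entries are `≥ i₀`. -/
def sortedIdxFrom : ℕ → Fin 3 → List (List (Fin 3))
  | 0, _ => [[]]
  | n + 1, i₀ => (List.finRange 3).flatMap fun i => if i < i₀ then [] else (sortedIdxFrom n i).map fun l => i :: l

/-- All sorted index lists of length `n`. -/
def sortedIdx (n : ℕ) : List (List (Fin 3)) := sortedIdxFrom n 0

/-- All variables of derivative order `n` (sorted index lists). -/
def varsOfOrder (n : ℕ) : List JVar := (List.finRange 3).flatMap fun a => (sortedIdx n).map fun l => (a, l)

/-- Unordered pairs `(lᵢ, lⱼ)`, `i ≤ j`, of a list. -/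
def pairsLE {α : Type} (l : List α) : List (α × α) :=
  (List.finRange l.length).flatMap fun i => (List.finRange l.length).flatMap fun j =>
    if i ≤ j then [(l.get i, l.get j)] else []

/-- Unordered triples `(lᵢ, lⱼ, lₖ)`, `i ≤ j ≤ k`, of a list. -/
def triplesLE {α : Type} (l : List α) : List (α × α × α) :=
  (List.finRange l.length).flatMap fun i => (List.finRange l.length).flatMap fun j =>
    (List.finRange l.length).flatMap fun m => if i ≤ j ∧ j ≤ m then [(l.get i, l.get j, l.get m)] else []

/-- The monomials of shape `(n₁, n₂, n₃)` (`n₁ ≤ n₂ ≤ n₃`): products of three variables of these orders, each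
unordered product listed once, as a sorted variable list. -/
def idxShape (n₁ n₂ n₃ : ℕ) : List (List JVar) :=
  if n₁ = n₂ ∧ n₂ = n₃ then (triplesLE (varsOfOrder n₁)).map fun t => sortVars [t.1, t.2.1, t.2.2]
  else if n₁ = n₂ then (pairsLE (varsOfOrder n₁)).flatMap fun pr => (varsOfOrder n₃).map fun v₃ =>
    sortVars [pr.1, pr.2, v₃]
  else if n₂ = n₃ then (varsOfOrder n₁).flatMap fun v₁ => (pairsLE (varsOfOrder n₂)).map fun pr =>
    sortVars [v₁, pr.1, pr.2]
  else (varsOfOrder n₁).flatMap fun v₁ => (varsOfOrder n₂).flatMap fun v₂ => (varsOfOrder n₃).map fun v₃ =>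
    sortVars [v₁, v₂, v₃]

/-- All shapes `n₁ ≤ n₂ ≤ n₃ ≤ 3` of weight `k`. -/
def shapes (k : ℕ) : List (List ℕ) :=
  (List.range 4).flatMap fun n₁ => (List.range 4).flatMap fun n₂ => (List.range 4).flatMap fun n₃ =>
    if n₁ + n₂ + n₃ = k ∧ n₁ ≤ n₂ ∧ n₂ ≤ n₃ then [[n₁, n₂, n₃]] else []

/-- The monomial basis of weight `k`: all unordered products of three variables of jet orders `≤ 3` and total
derivative weight `k`, each once, as sorted variable lists (831 for `k = 3`, 4509 for `k = 5`). -/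
def idx (k : ℕ) : List (List JVar) :=
  (shapes k).flatMap fun sh => idxShape (sh.getD 0 0) (sh.getD 1 0) (sh.getD 2 0)

/-- The coefficient space of weight `k`: real coefficient vectors on the monomial basis `idx k`. -/
abbrev V (k : ℕ) := Fin (idx k).length → ℝ

/-- The real jet polynomial with coefficient vector `τ`. -/
noncomputable def polyOfV (k : ℕ) (τ : V k) : JPoly ℝ := (List.finRange (idx k).length).map fun i => (τ i, (idx k).get i)

/-- The density of a coefficient vector. -/
noncomputable def densV (k : ℕ) (τ : V k) : Jet3 → ℝ := (polyOfV k τ).dens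

/-- The matrix of the substitution action of `g` on the monomial basis of weight `k`:
entry `(i, j)` = coefficient of the monomial `idx k [i]` in `act g (idx k [j])`. -/
def actMatrix {R : Type} [Mul R] [One R] [Add R] [Zero R] (k : ℕ) (g : Matrix (Fin 3) (Fin 3) R) :
    Matrix (Fin (idx k).length) (Fin (idx k).length) R :=
  Matrix.of fun i j => JPoly.coeffOf (JPoly.act g [(1, (idx k).get j)]) ((idx k).get i)

/-! ### The groups: signed permutation matrices, the rational rotation -/

/-- The signed permutation matrix with `(g x)_i = ε_i x_{σ⁻¹ i}`, i.e. `g i j = ε i` if `j = σ⁻¹ i` (the matrix of the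
tree's `signedPerm σ ε`). -/
def signedPermMatrix {R : Type} [Zero R] [One R] [Neg R] (σ : Equiv.Perm (Fin 3)) (ε : Fin 3 → Bool) :
    Matrix (Fin 3) (Fin 3) R :=
  Matrix.of fun i j => if j = σ.symm i then (if ε i then 1 else -1) else 0

/-- The six permutations of `Fin 3` (computable list). -/
def permList : List (Equiv.Perm (Fin 3)) :=
  [1, Equiv.swap 0 1, Equiv.swap 0 2, Equiv.swap 1 2, (Equiv.swap 0 1).trans (Equiv.swap 0 2),
    (Equiv.swap 0 2).trans (Equiv.swap 0 1)]

/-- The eight sign vectors (computable list; `true` = `+1`). -/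
def signList : List (Fin 3 → Bool) :=
  [true, false].flatMap fun b₀ => [true, false].flatMap fun b₁ => [true, false].map fun b₂ => ![b₀, b₁, b₂]

/-- The 48 elements of `B₃` as pairs (permutation, signs) (computable list). -/
def b3List : List (Equiv.Perm (Fin 3) × (Fin 3 → Bool)) :=
  permList.flatMap fun σ => signList.map fun ε => (σ, ε)

/-- The rational rotation about the third axis with `cos = 3/5`, `sin = 4/5`. -/
def rotZ {R : Type} [Field R] : Matrix (Fin 3) (Fin 3) R :=
  Matrix.of fun i j =>
    if i = 0 ∧ j = 0 then 3 / 5 else if i = 0 ∧ j = 1 then -(4 / 5) else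
    if i = 1 ∧ j = 0 then 4 / 5 else if i = 1 ∧ j = 1 then 3 / 5 else
    if i = 2 ∧ j = 2 then 1 else 0

/-! ### The monomial action of `B₃`, orbit sums -/

/-- The sign `±1` of a Boolean sign flag. -/
def sgn (b : Bool) : ℤ := if b then 1 else -1

/-- The signed coordinate permutation `(σ, ε)` acts on a jet variable MONOMIALLY: `∂^l v_a ↦ ± ∂^{σ⁻¹ l} v_{σ⁻¹ a}` with
the sign `ε_a Π_s ε_{l_s}` (the only non-zero term of `actVar (signedPermMatrix σ ε)`). Returns (sign, variable). -/
def permActVar (σ : Equiv.Perm (Fin 3)) (ε : Fin 3 → Bool) (v : JVar) : ℤ × JVar :=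
  (sgn (ε v.1) * (v.2.map fun i => sgn (ε i)).prod, (σ.symm v.1, sortIdx (v.2.map σ.symm)))

/-- The monomial action of a signed coordinate permutation on a monomial: (sign, sorted image monomial). -/
def permAct (σ : Equiv.Perm (Fin 3)) (ε : Fin 3 → Bool) (m : List JVar) : ℤ × List JVar :=
  ((m.map fun v => (permActVar σ ε v).1).prod, sortVars (m.map fun v => (permActVar σ ε v).2))

/-- The `B₃`-orbit sum of a monomial, `Σ_{g ∈ B₃} sign(g, m) · (g m)`, collected (integer coefficients; zero
polynomial for self-cancelling orbits; otherwise every monomial of the orbit appears with coefficient `± |Stab m|`). -/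
def orbitSum (m : List JVar) : JPoly ℤ :=
  JPoly.norm (b3List.map fun g => ((permAct g.1 g.2 m).1, (permAct g.1 g.2 m).2))

/-- The normalised orbit sum: coefficients replaced by their signs (`±1` on the orbit). -/
def orbitSumN (m : List JVar) : JPoly ℤ := (orbitSum m).map fun t => (Int.sign t.1, t.2)

/-- The derivative weight of a monomial (total number of derivative indices). -/
def monoWeight (m : List JVar) : ℕ := (m.map fun v => v.2.length).sum

/-! ### Isotropic densities: complete contractions -/

/-- Perfect matchings of a list of slots (each matching as a list of pairs); `fuel` bounds the recursion depth
(use `fuel ≥ length / 2`). -/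
def matchings {α : Type} : ℕ → List α → List (List (α × α))
  | _, [] => [[]]
  | _, [_] => []
  | 0, _ :: _ :: _ => []
  | fuel + 1, a :: b :: rest =>
    -- pair `a` with `b`, or with some element of `rest`
    ((matchings fuel rest).map fun m => (a, b) :: m) ++
      ((List.finRange rest.length).flatMap fun t =>
        (matchings fuel (b :: rest.eraseIdx t)).map fun m => (a, rest.getD t a) :: m)

/-- The contraction density of a shape `(n₁, n₂, n₃)` and a perfect matching of its slots `(factor, position)`
(position `0` = the component, `1 … n_t` = the derivative indices): `Σ` over index values `Fin 3` per pair of the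
monomial whose factor `t` has component = value at `(t,0)` and derivative indices = values at `(t,1..n_t)`. -/
def contractionOf (shape : List ℕ) (m : List ((ℕ × ℕ) × (ℕ × ℕ))) : JPoly ℚ :=
  let assignments : List (List (((ℕ × ℕ) × (ℕ × ℕ)) × Fin 3)) :=
    m.foldr (fun pr acc => (List.finRange 3).flatMap fun c => acc.map fun as => (pr, c) :: as) [[]]
  let valueAt (as : List (((ℕ × ℕ) × (ℕ × ℕ)) × Fin 3)) (s : ℕ × ℕ) : Fin 3 :=
    match as.find? (fun pc => pc.1.1 = s ∨ pc.1.2 = s) with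
    | some pc => pc.2
    | none => 0
  JPoly.collect (assignments.map fun as =>
    ((1 : ℚ), sortVars ((List.range shape.length).map fun t =>
      (valueAt as (t, 0), sortIdx ((List.range (shape.getD t 0)).map fun s => valueAt as (t, s + 1))))))

/-- The isotropic contraction densities of weight `k` (all shapes, all perfect matchings of the `3 + k` slots). -/
def contractions (k : ℕ) : List (JPoly ℚ) :=
  (shapes k).flatMap fun sh =>
    (matchings (k + 3) ((List.range sh.length).flatMap fun t => (List.range (sh.getD t 0 + 1)).map fun s => (t, s))).map
      fun m => contractionOf sh m

end Summit.NavierStokesRegularity.NavierStokesRegularity.Theorems.OddMorawetz
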